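import Summits.AtomisticToContinuum.HydrodynamicLimit.Theses.JParityClosure
import Summits.AtomisticToContinuum.HydrodynamicLimit.Theorems.JParityClosureParitySplit
import Summits.AtomisticToContinuum.HydrodynamicLimit.Theorems.JParityClosureParityRigidity
import Summits.AtomisticToContinuum.HydrodynamicLimit.Theorems.JParityClosureEmpiricalEnskogIdentity

/-!
# Route JParityClosure — reductions of the `Assembly` item (stmt-AtomisticToContinuum-17595)

The rev-3 assembly item of route `route-AtomisticToContinuum-JParityClosure` is
`Assembly := (OddContactSymmetry ∧ EvenStressEnskog ∧ RateFloor ∧ LocalSecondLaw ∧ DensityCap)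
→ _root_.HydrodynamicLimit`, the UNCURRIED TWIN of the route's closure crux
`ParityBandClosure := OddContactSymmetry → EvenStressEnskog → RateFloor → LocalSecondLaw →
DensityCap → _root_.HydrodynamicLimit` (crux 7, stmt-AtomisticToContinuum-17608).

This file records, kernel-checked, the bookkeeping that ties the item to the rest of the route:

* `jParityClosure_assembly_iff_parityBandClosure` — `Assembly ↔ ParityBandClosure` (currying):
  the item carries exactly the content of crux 7 and closes in one line the moment crux 7 does
  (`jParityClosure_assembly_of_parityBandClosure`); conversely a proof of the item proves crux 7
  (`jParityClosure_parityBandClosure_of_assembly`), so with the five physics cruxes it feeds the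
  route's deciding theorem `JParityClosure.closes` (`jParityClosure_statement_of_assembly`).
* `jParityClosure_assembly_of_parityInBand` — the foreseen glue: the typed glue `ParityInBand`
  (stmt-13088) fed with the open supports `CollisionTightness` (stmt-13085) and
  `KineticEnergyTails` (stmt-13087) and the four PROVED supports (`paritySplit_proof`,
  `parityRigidity_proof`, `empiricalEnskogIdentity_proof`, `hsEosLowDensity_proof`) gives the
  item; the conclusion of `ParityInBand` is verbatim the body of `_root_.HydrodynamicLimit`.
* `jParityClosure_assembly_of_hydrodynamicLimit` — the item is implied by the sub-problem
  Statement itself (it is a frame statement `X → Statement`).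

No new definitions; pure propositional bookkeeping over the route file.
-/

namespace Summit.AtomisticToContinuum.HydrodynamicLimit.Theorems

open Summit.AtomisticToContinuum.HydrodynamicLimit.Theses

/-- **`Assembly ↔ ParityBandClosure`** (route JParityClosure, items stmt-AtomisticToContinuum-17595
and stmt-AtomisticToContinuum-17608): the assembly item is the uncurried form of the closure
crux — `(A ∧ B ∧ C ∧ D ∧ E) → S` versus `A → B → C → D → E → S`. -/
theorem jParityClosure_assembly_iff_parityBandClosure :
    JParityClosure.Assembly ↔ JParityClosure.ParityBandClosure := by
  unfold JParityClosure.Assembly JParityClosure.ParityBandClosure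
  constructor
  · exact fun h h₂ h₃ h₄ h₅ h₆ => h ⟨h₂, h₃, h₄, h₅, h₆⟩
  · exact fun h hX => h hX.1 hX.2.1 hX.2.2.1 hX.2.2.2.1 hX.2.2.2.2

/-- The closure crux `ParityBandClosure` (stmt-AtomisticToContinuum-17608) implies the assembly
item `Assembly` (stmt-AtomisticToContinuum-17595) — the one-line closing step once crux 7 lands. -/
theorem jParityClosure_assembly_of_parityBandClosure (h : JParityClosure.ParityBandClosure) :
    JParityClosure.Assembly :=
  jParityClosure_assembly_iff_parityBandClosure.2 h

/-- Conversely, the assembly item `Assembly` (stmt-AtomisticToContinuum-17595) implies the closure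
crux `ParityBandClosure` (stmt-AtomisticToContinuum-17608). -/
theorem jParityClosure_parityBandClosure_of_assembly (h : JParityClosure.Assembly) :
    JParityClosure.ParityBandClosure :=
  jParityClosure_assembly_iff_parityBandClosure.1 h

/-- With the five physics cruxes, the assembly item yields the sub-problem Statement
`_root_.HydrodynamicLimit` through the route's deciding theorem `JParityClosure.closes`
(the item can stand in for crux 7 there). -/
theorem jParityClosure_statement_of_assembly (hA : JParityClosure.Assembly)
    (h₂ : JParityClosure.OddContactSymmetry) (h₃ : JParityClosure.EvenStressEnskog)
    (h₄ : JParityClosure.RateFloor) (h₅ : JParityClosure.LocalSecondLaw)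
    (h₆ : JParityClosure.DensityCap) : _root_.HydrodynamicLimit :=
  JParityClosure.closes h₂ h₃ h₄ h₅ h₆ (jParityClosure_parityBandClosure_of_assembly hA)

/-- **The foreseen glue of the item.** The typed glue `ParityInBand` (stmt-AtomisticToContinuum-13088)
together with the open supports `CollisionTightness` (stmt-13085) and `KineticEnergyTails`
(stmt-13087) implies `Assembly`, the four remaining supports being PROVED in the tree
(`paritySplit_proof`, `parityRigidity_proof`, `empiricalEnskogIdentity_proof`,
`hsEosLowDensity_proof`); the conclusion of `ParityInBand` is syntactically the body of
`_root_.HydrodynamicLimit`. -/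
theorem jParityClosure_assembly_of_parityInBand (hPIB : JParityClosure.ParityInBand)
    (hCT : JParityClosure.CollisionTightness) (hKET : JParityClosure.KineticEnergyTails) :
    JParityClosure.Assembly := by
  unfold JParityClosure.Assembly
  rintro ⟨h₂, h₃, h₄, h₅, h₆⟩
  exact hPIB h₂ h₃ h₄ h₅ h₆ paritySplit_proof parityRigidity_proof hCT empiricalEnskogIdentity_proof
    hKET hsEosLowDensity_proof

/-- The assembly item is a frame statement `X → Statement`: it is implied by the sub-problem
Statement `_root_.HydrodynamicLimit` itself (so it cannot be refuted without refuting the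
Statement). -/
theorem jParityClosure_assembly_of_hydrodynamicLimit (h : _root_.HydrodynamicLimit) :
    JParityClosure.Assembly :=
  fun _ => h

end Summit.AtomisticToContinuum.HydrodynamicLimit.Theorems
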